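import Literature.NumberTheory.EllipticCurves.InertiaReductionAutomorphismProofs
import Literature.NumberTheory.EllipticCurves.HasseWeilAbelianConductorSwanIndependenceTwoProofs
import Literature.NumberTheory.EllipticCurves.SwanConductorTorsionDichotomyProofs
import Literature.NumberTheory.GaloisRepresentations.ArtinConductorHerbrandProofs
import Literature.NumberTheory.GaloisRepresentations.RamificationFiltrationProofs
import HarnessLib

/-!
# Inertia and the `3`-torsion through an explicit good model: a coordinate-free criterion

`Proofs` file (theorems only, no definitions, no named facts, no instances) in topic
`NumberTheory/EllipticCurves`, landed by the seat of bsd.S15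
(`Literature.NumberTheory.EllipticCurves.conductorNorm_eq_artinConductorNat_of_isElliptic`) for
the Galois side of Ogg's formula at `2` (Silverman *ATAEC* Thm. IV.11.1, `p = 2`, PDF p. 366) in
the classes with non-abelian inertia: it turns the question *"does the inertial automorphism `σ`
fix `E[3]` pointwise?"* into a congruence on an explicit change of variables, with **no torsion
coordinates**.

## Setting and results (valued-field level, as `InertiaReductionAutomorphismProofs`)

`(L, w)` a valued field, `F ⊆ L` a subfield, `X` a Weierstrass equation over `F`, `C` a change of
variables over `L` with `C • X_L = W₀ ⊗ L` for a `w`-integral `W₀` with unit discriminant (an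
explicit good model), `σ ∈ Aut(L/F)` an isometry acting trivially on the residue field.

* `exists_integralLift_reducedAut_red_map_eq` — the Serre–Tate mechanism of
  `exists_reducedAut_red_map_eq` (same proof, due to the tenured seat of bsd.S15) with the reduced
  automorphism made **explicit**: `A_σ := C (σC)⁻¹` has an integral lift `A₀` and, with
  `Ã := A₀ mod 𝔪_w`, `Ã • W̃₀ = W̃₀` and `red(Φ(P^σ)) = Ã(red(Φ P))` for all `P ∈ X(L)`;
* `VariableChange.eq_one_of_three_fixedPoints` — a change of coordinates `Ã` with `Ã • V = V`
  fixing three affine points `(x₁, y₁)`, `(x₁, y₁')` (`y₁ ≠ y₁'`) and `(x₂, y₂)` (`x₂ ≠ x₁`) is `1`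
  (elementary: `μ²(x - r) = x` at two abscissae gives `μ² = 1`, `r = 0`; the two ordinates over
  `x₁` give `μ³ = 1`; then `sx + t = 0` at two abscissae);
* `forall_map_three_torsion_eq_iff_val` — for `L` algebraically closed of characteristic `0`, `X`
  elliptic and `w(3) = 1`: **`σ` fixes every `3`-torsion point of `X(L)` iff
  `A_σ ≡ 1 (mod 𝔪_w)`**, i.e. `w(u_A - 1) < 1`, `w(r_A) < 1`, `w(s_A) < 1`, `w(t_A) < 1`.
  (`⇐`: `Ã = 1`, so `red ∘ Φ` is `σ`-invariant and `Φ(P^σ - P)` is a `3`-torsion point of the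
  kernel of reduction; `⇒`: the reductions of the eight non-zero `3`-torsion points are distinct
  (`E[3] ↪ Ẽ`, *AEC* VII.3.1(b)), at most two of them over each abscissa, all fixed by `Ã`, so
  `Ã = 1` by the three-point lemma.)

## Results (number-field level)

* `forall_smul_geomTorsion_three_eq_iff_of_goodModel` — for `E/K` elliptic over a number field,
  `v ∤ 3`, `𝔓 ∣ v`, an explicit good model `C • E_F` over a normal `F ⊆ K̄` (coefficients
  `𝔓`-integral, discriminant a `𝔓`-unit, as fractions of absolute integers) and `σ ∈ I_𝔓`:
  **`σ` fixes `E[3]` pointwise iff `A_σ = C (σC)⁻¹ ≡ 1 (mod 𝔓)`** (transport to `K̄_v` as in the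
  tenured seat's `forall_smul_torsion_eq_of_forall_smul_torsion_pow_eq_of_valuation_j_le_one`);
* `swanConductorAt_torsion_three_eq_two_mul_volume_of_forall_iff` —
  **`Sw_𝔓(E[3]) = 2 · vol {u > 0 : Gal(F/K)^u(𝔓 ∩ F) ⊄ N}`** whenever `σ ∈ I_𝔓` fixes `E[3]` iff
  `σ|_F ∈ N`; with the previous theorem, the wild conductor above `2` is read off the upper
  filtration of the explicit field `F` and the congruence classes of the `A_τ`, `τ ∈ Gal(F/K)`.

How this is used for Ogg's formula at `2` (classes with non-abelian inertia, where no twist to a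
tame curve exists): a certificate `(F, C)` — `F = K₀(α)` with `α` Eisenstein of degree `8` or `24`
over an unramified `K₀`, `C` found by computer algebra — reduces `Sw_𝔓(E[3])` to valuations in
`ℤ_{K₀}[α]` (read off coefficients) and the upper filtration of `Gal(F/K)` (from
`i_G(τ) = ord(τα - α)`), uniformly on `2`-adic balls of coefficients (the same `C` works).

## References

* J.-P. Serre, J. Tate, *Good reduction of abelian varieties*, Ann. of Math. 88 (1968), §2
  Thm. 2 (mechanism), §3. [SerreTate1968]
* J. H. Silverman, *The Arithmetic of Elliptic Curves*, 2nd ed. (2009), III.1 Table 3.1,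
  VII.1 Prop. 1.3(d), VII.2 Prop. 2.1, VII.3 Prop. 3.1(b), III.10. [SilvermanAEC2009]
* J. H. Silverman, *Advanced Topics*, §IV.10 (PDF p. 358), Thm. IV.11.1 (`p = 2`: p. 366).
  [SilvermanATAEC1994]

## Design

Theorems only; `noncomputable section`; `namespace Literature.NumberTheory.EllipticCurves`; the
valued-field level of `InertiaReductionAutomorphismProofs` (`w : Valuation L ℝ≥0`).  Axioms:
`propext`, `Classical.choice`, `Quot.sound`.
-/

noncomputable section

open scoped Classical NNReal NumberField Pointwise
open WeierstrassCurve Field IsDedekindDomain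

universe u

namespace WeierstrassCurve.VariableChange

variable {k : Type*} [Field k] {V : WeierstrassCurve k}

/-- **Three fixed points force the identity.**  If `Ã • V = V` and the induced self-map of `V(k)`
fixes the affine points `(x₁, y₁)`, `(x₁, y₁')` with `y₁ ≠ y₁'` and `(x₂, y₂)` with `x₂ ≠ x₁`,
then `Ã = 1`: the fixed-point equations are `μ²(x - r) = x`, `μ³(y - s(x - r) - t) = y`
(`μ = u⁻¹`); two abscissae give `μ² = 1` and `r = 0`, the two ordinates over `x₁` give `μ³ = 1`,
so `μ = 1`, and then `sx + t = 0` at `x₁ ≠ x₂` gives `s = t = 0`.  (The finite form of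
`eq_one_of_infinite_fixedPoints` needed for the `3`-torsion.)
[cite: SilvermanAEC2009, III.1 Table 3.1 and III.10] -/
theorem eq_one_of_three_fixedPoints {A : VariableChange k} (hA : A • V = V)
    {x₁ y₁ y₁' x₂ y₂ : k} (h₁ : V.toAffine.Nonsingular x₁ y₁) (h₁' : V.toAffine.Nonsingular x₁ y₁')
    (h₂ : V.toAffine.Nonsingular x₂ y₂) (hy : y₁ ≠ y₁') (hx : x₂ ≠ x₁)
    (hP₁ : Affine.Point.congrEquiv hA (pointEquiv V A (.some x₁ y₁ h₁)) = .some x₁ y₁ h₁)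
    (hP₁' : Affine.Point.congrEquiv hA (pointEquiv V A (.some x₁ y₁' h₁')) = .some x₁ y₁' h₁')
    (hP₂ : Affine.Point.congrEquiv hA (pointEquiv V A (.some x₂ y₂ h₂)) = .some x₂ y₂ h₂) :
    A = 1 := by
  set μ : k := ((A.u⁻¹ : kˣ) : k) with hμ
  have hμ0 : μ ≠ 0 := Units.ne_zero _
  have hfix : ∀ {x y : k} (h : V.toAffine.Nonsingular x y),
      Affine.Point.congrEquiv hA (pointEquiv V A (.some x y h)) = .some x y h →
        μ ^ 2 * (x - A.r) = x ∧ μ ^ 3 * (y - A.s * (x - A.r) - A.t) = y := by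
    intro x y h hP
    rw [pointEquiv_some, Affine.Point.congrEquiv_some, Affine.Point.some.injEq] at hP
    exact ⟨hP.1, hP.2⟩
  obtain ⟨ex₁, ey₁⟩ := hfix h₁ hP₁
  obtain ⟨-, ey₁'⟩ := hfix h₁' hP₁'
  obtain ⟨ex₂, ey₂⟩ := hfix h₂ hP₂
  -- `μ² = 1` and `r = 0`
  have hx21 : x₂ - x₁ ≠ 0 := sub_ne_zero.mpr hx
  have hμ2 : μ ^ 2 = 1 := by
    have e : (μ ^ 2 - 1) * (x₂ - x₁) = 0 := by linear_combination ex₂ - ex₁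
    rcases mul_eq_zero.mp e with h | h
    · exact sub_eq_zero.mp h
    · exact absurd h hx21
  have hr : A.r = 0 := by
    have e : μ ^ 2 * A.r = 0 := by linear_combination (x₁ : k) * hμ2 - ex₁
    rcases mul_eq_zero.mp e with h | h
    · exact absurd h (pow_ne_zero 2 hμ0)
    · exact h
  -- `μ³ = 1`, so `μ = 1`
  have hy11 : y₁ - y₁' ≠ 0 := sub_ne_zero.mpr hy
  have hμ3 : μ ^ 3 = 1 := by
    have e : (μ ^ 3 - 1) * (y₁ - y₁') = 0 := by linear_combination ey₁ - ey₁'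
    rcases mul_eq_zero.mp e with h | h
    · exact sub_eq_zero.mp h
    · exact absurd h hy11
  have hμ1 : μ = 1 := by
    have : μ ^ 3 = μ ^ 2 * μ := by ring
    rw [this, hμ2, one_mul] at hμ3
    exact hμ3
  -- `s = t = 0`
  have hs : A.s = 0 := by
    have e : A.s * (x₂ - x₁) = 0 := by
      rw [hr, hμ1] at ey₁ ey₂
      linear_combination ey₁ - ey₂
    rcases mul_eq_zero.mp e with h | h
    · exact h
    · exact absurd h hx21
  have ht : A.t = 0 := by
    rw [hr, hμ1, hs] at ey₁
    linear_combination -ey₁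
  have hu : A.u = 1 := by
    have : (A.u⁻¹ : kˣ) = 1 := Units.ext (by rw [← hμ, hμ1, Units.val_one])
    simpa using this
  cases A
  simp only [VariableChange.one_def, VariableChange.mk.injEq]
  exact ⟨hu, hr, hs, ht⟩

/-- The self-map of `V(k)` induced by the identity change of variables (transported along any
proof of `A • V = V` with `A = 1`) is the identity. [folklore] -/
theorem congrEquiv_pointEquiv_eq_self_of_eq_one {A : VariableChange k} (hA : A • V = V)
    (h1 : A = 1) (P : V.toAffine.Point) :
    Affine.Point.congrEquiv hA (pointEquiv V A P) = P := by
  subst h1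
  rcases P with _ | ⟨x, y, h⟩
  · simp only [← Affine.Point.zero_def, map_zero]
  · rw [pointEquiv_some, Affine.Point.congrEquiv_some]
    exact Literature.NumberTheory.EllipticCurves.point_some_congr
      (Literature.NumberTheory.EllipticCurves.toX_one x)
      (Literature.NumberTheory.EllipticCurves.toY_one x y)

end WeierstrassCurve.VariableChange

namespace Literature.NumberTheory.EllipticCurves

/-! ## §1. The reduced automorphism of an inertial isometry, explicitly -/

section Core

variable {L : Type u} [Field L] {w : Valuation L ℝ≥0}
  {F : Type*} [Field F] [Algebra F L]

set_option maxHeartbeats 800000 in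
/-- **The Serre–Tate mechanism with the reduced automorphism made explicit.**  In the setting of
`exists_reducedAut_red_map_eq` (`C • X_L = W₀ ⊗ L` a `w`-integral model with unit discriminant,
`σ ∈ Aut(L/F)` an isometry trivial on the residue field): the change of variables
`A_σ = C (σC)⁻¹` (which satisfies `A_σ • σ(W₀ ⊗ L) = W₀ ⊗ L`) has an integral lift `A₀` over
`𝒪_w` (*AEC* VII.1.3(d), `val_le_one_of_smul_eq_of_val_Δ_eq_one`), its reduction `Ã = A₀ mod 𝔪_w`
satisfies `Ã • W̃₀ = W̃₀`, and `red(Φ(P^σ)) = Ã(red(Φ P))` for every `P ∈ X(L)`.  The proof is that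
of `exists_reducedAut_red_map_eq` (tenured seat of bsd.S15), verbatim, keeping `A₀` in the
conclusion. [cite: SerreTate1968, §2 Thm. 2 (mechanism of proof)]
[cite: SilvermanAEC2009, VII.1 Prop. 1.3(d) and VII.2 Prop. 2.1] -/
theorem exists_integralLift_reducedAut_red_map_eq (X : WeierstrassCurve F) (C : VariableChange L)
    {W₀ : WeierstrassCurve w.integer} (hW₀ : C • X.baseChange L = W₀.baseChange L)
    (hΔ : IsUnit W₀.Δ) (σ : L ≃ₐ[F] L) (hσ : ∀ z, w (σ z) = w z)
    (hσI : ∀ z, w z ≤ 1 → w (σ z - z) < 1) :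
    ∃ (A₀ : VariableChange w.integer)
      (hÃ : A₀.map (IsLocalRing.residue w.integer) • W₀.map (IsLocalRing.residue w.integer) =
        W₀.map (IsLocalRing.residue w.integer)),
      A₀.map (algebraMap w.integer L) = C * (C.map (σ : L →+* L))⁻¹ ∧
      ∀ P : (X.baseChange L).toAffine.Point,
        goodReductionHom W₀ (Valuation.integer.integers w) hΔ
            (Affine.Point.congrEquiv hW₀ (VariableChange.pointEquiv (X.baseChange L) C
              (Affine.Point.map (σ : L →ₐ[F] L) P))) =
          Affine.Point.congrEquiv hÃ (VariableChange.pointEquiv _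
            (A₀.map (IsLocalRing.residue w.integer))
            (goodReductionHom W₀ (Valuation.integer.integers w) hΔ
              (Affine.Point.congrEquiv hW₀ (VariableChange.pointEquiv (X.baseChange L) C P)))) := by
  have hv0 : w.Integers w.integer := Valuation.integer.integers w
  have hinj : Function.Injective (algebraMap w.integer L) := hv0.hom_inj
  haveI hell : (W₀.map (IsLocalRing.residue w.integer)).IsElliptic := isElliptic_map_residue hΔ
  let O := w.integer
  let k := IsLocalRing.ResidueField w.integer
  set σr : L →+* L := (σ : L →+* L) with hσr
  -- `σ` restricted to `𝒪_w`, congruent to the identity modulo `𝔪_w`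
  have hσO : ∀ x ∈ w.integer, σr x ∈ w.integer := fun x hx ↦ by
    rw [Valuation.mem_integer_iff] at hx ⊢
    rw [hσr]; change w (σ x) ≤ 1; rw [hσ]; exact hx
  set σ₀ : O →+* O := σr.restrict w.integer w.integer hσO with hσ₀
  have hσ₀L : ∀ a : O, algebraMap O L (σ₀ a) = σ (algebraMap O L a) := fun a ↦ rfl
  have hres : ∀ a : O, IsLocalRing.residue O (σ₀ a) = IsLocalRing.residue O a := by
    intro a
    rw [← sub_eq_zero, ← map_sub, IsLocalRing.residue_eq_zero_iff, IsLocalRing.mem_maximalIdeal,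
      mem_nonunits_iff, hv0.isUnit_iff_valuation_eq_one]
    intro h1
    have hlt := hσI (algebraMap O L a) (hv0.map_le_one a)
    rw [← hσ₀L, ← map_sub, h1] at hlt
    exact lt_irrefl _ hlt
  have hresσ : (IsLocalRing.residue O).comp σ₀ = IsLocalRing.residue O := RingHom.ext hres
  -- `σ(W') = A • ...`: the change of variables `A = C (σC)⁻¹`
  set A : VariableChange L := C * (C.map σr)⁻¹ with hA
  have hXσ : (X.baseChange L).map σr = X.baseChange L := X.map_baseChange (σ : L →ₐ[F] L)
  have hVσ : (W₀.baseChange L).map σr = (W₀.map σ₀).baseChange L := by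
    rw [WeierstrassCurve.baseChange, WeierstrassCurve.baseChange, WeierstrassCurve.map_map,
      WeierstrassCurve.map_map]
    congr 1
  have hAW : A • (W₀.map σ₀).baseChange L = W₀.baseChange L := by
    rw [← hVσ, ← hW₀, ← map_variableChange, hXσ, hA, mul_smul, inv_smul_smul]
  -- `A` is integral: lift it to `A₀` over `𝒪_w`
  haveI : ((W₀.map σ₀).baseChange L).IsIntegral O := ⟨W₀.map σ₀, rfl⟩
  haveI : (A • (W₀.map σ₀).baseChange L).IsIntegral O := by rw [hAW]; exact ⟨W₀, rfl⟩
  have hΔL : w (W₀.baseChange L).Δ = 1 := by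
    rw [WeierstrassCurve.baseChange, map_Δ]
    exact (hv0.isUnit_iff_valuation_eq_one).mp hΔ
  have hΔσ : w ((W₀.map σ₀).baseChange L).Δ = 1 := by
    rw [← hVσ, map_Δ, hσr]
    change w (σ (W₀.baseChange L).Δ) = 1
    rw [hσ, hΔL]
  obtain ⟨hu, hr, hs, ht⟩ := val_le_one_of_smul_eq_of_val_Δ_eq_one ((W₀.map σ₀).baseChange L) A
    hΔσ (by rw [hAW]; exact hΔL)
  have huu : IsUnit (⟨(A.u : L), le_of_eq hu⟩ : O) := (hv0.isUnit_iff_valuation_eq_one).mpr hu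
  set A₀ : VariableChange O := ⟨huu.unit, ⟨A.r, hr⟩, ⟨A.s, hs⟩, ⟨A.t, ht⟩⟩ with hA₀
  have hA₀A : A₀.map (algebraMap O L) = A := by
    rw [hA₀]
    ext
    · simp only [VariableChange.map, Units.coe_map, MonoidHom.coe_coe, IsUnit.unit_spec]; rfl
    · rfl
    · rfl
    · rfl
  have hA₀W : A₀ • W₀.map σ₀ = W₀ := by
    apply WeierstrassCurve.map_injective hinj
    change (A₀ • W₀.map σ₀).baseChange L = W₀.baseChange L
    rw [WeierstrassCurve.baseChange, ← map_variableChange, hA₀A]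
    exact hAW
  -- the reduced change of variables
  set Ã : VariableChange k := A₀.map (IsLocalRing.residue O) with hÃdef
  have hÃ : Ã • W₀.map (IsLocalRing.residue O) = W₀.map (IsLocalRing.residue O) := by
    have h' : (A₀ • W₀.map σ₀).map (IsLocalRing.residue O) = W₀.map (IsLocalRing.residue O) := by
      rw [hA₀W]
    rw [← map_variableChange, WeierstrassCurve.map_map, hresσ] at h'
    exact h'
  refine ⟨A₀, hÃ, hA₀A, fun P ↦ ?_⟩
  -- the coordinate identities `C.toX (σ x) = A.toX (σ (C.toX x))` etc.
  have hAC : A * C.map σr = C := by rw [hA, inv_mul_cancel_right]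
  have keyX : ∀ x : L, C.toX (σ x) = A.toX (σ (C.toX x)) := fun x ↦ by
    change C.toX (σr x) = A.toX (σr (C.toX x))
    rw [map_toX_ringHom, ← toX_mul, hAC]
  have keyY : ∀ x y : L, C.toY (σ x) (σ y) = A.toY (σ (C.toX x)) (σ (C.toY x y)) := fun x y ↦ by
    change C.toY (σr x) (σr y) = A.toY (σr (C.toX x)) (σr (C.toY x y))
    rw [map_toX_ringHom, map_toY_ringHom, ← toY_mul, hAC]
  rcases P with _ | ⟨x, y, h⟩
  · simp only [← Affine.Point.zero_def, map_zero]
  -- normalise `P^σ = (σ x, σ y)`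
  have hσns : (X.baseChange L).toAffine.Nonsingular (σ x) (σ y) := by
    have h1 : ((X.baseChange L).map σr).toAffine.Nonsingular (σ x) (σ y) :=
      (Affine.map_nonsingular _ σr.injective x y).mpr h
    rwa [hXσ] at h1
  have hmapP : Affine.Point.map (σ : L →ₐ[F] L) (.some x y h) = .some (σ x) (σ y) hσns := by
    rw [Affine.Point.map_some]
    exact point_some_congr rfl rfl
  rw [hmapP]
  -- `Φ P = (x', y')`
  set x' := C.toX x with hx'
  set y' := C.toY x y with hy'
  rw [VariableChange.pointEquiv_some, VariableChange.pointEquiv_some,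
    Affine.Point.congrEquiv_some, Affine.Point.congrEquiv_some]
  simp only [goodReductionHom_apply]
  have hnsΦ : (W₀.baseChange L).toAffine.Nonsingular x' y' :=
    hW₀ ▸ (VariableChange.nonsingular_iff (X.baseChange L) C x y).mpr h
  have hnsΦσ : (W₀.baseChange L).toAffine.Nonsingular (C.toX (σ x)) (C.toY (σ x) (σ y)) :=
    hW₀ ▸ (VariableChange.nonsingular_iff (X.baseChange L) C (σ x) (σ y)).mpr hσns
  by_cases hxint : w x' ≤ 1
  · -- integral point: both sides reduce to `(Ã x̄', Ã ȳ')`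
    have hyint : w y' ≤ 1 := v_Y_le_one_of_v_X_le_one hv0 (W := W₀) hnsΦ.1 hxint
    obtain ⟨a, ha⟩ := hv0.exists_of_le_one hxint
    obtain ⟨b, hb⟩ := hv0.exists_of_le_one hyint
    have hnsP : (W₀.baseChange L).toAffine.Nonsingular (algebraMap O L a) (algebraMap O L b) := by
      rw [ha, hb]; exact hnsΦ
    have hred₁ : WeierstrassCurve.reducePoint W₀ (.some x' y' hnsΦ) =
        .some (IsLocalRing.residue O a) (IsLocalRing.residue O b)
          ((WeierstrassCurve.hasNonsingularReduction_some_algebraMap_iff hinj hnsP).mp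
            (hasNonsingularReduction_of_isUnit_Δ hv0 hΔ _)) := by
      rw [← WeierstrassCurve.reducePoint_some_algebraMap hinj hnsP]
      congr 1
      exact point_some_congr ha.symm hb.symm
    have hX2 : A.toX (σ x') = algebraMap O L (A₀.toX (σ₀ a)) := by
      rw [map_toX_ringHom, hA₀A, hσ₀L, ha]
    have hY2 : A.toY (σ x') (σ y') = algebraMap O L (A₀.toY (σ₀ a) (σ₀ b)) := by
      rw [map_toY_ringHom, hA₀A, hσ₀L, hσ₀L, ha, hb]
    have hns2 : (W₀.baseChange L).toAffine.Nonsingular (algebraMap O L (A₀.toX (σ₀ a)))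
        (algebraMap O L (A₀.toY (σ₀ a) (σ₀ b))) := by
      rw [← hX2, ← hY2, ← keyX, ← keyY]
      exact hnsΦσ
    have hred₂ : WeierstrassCurve.reducePoint W₀ (.some (C.toX (σ x)) (C.toY (σ x) (σ y)) hnsΦσ) =
        .some (IsLocalRing.residue O (A₀.toX (σ₀ a)))
          (IsLocalRing.residue O (A₀.toY (σ₀ a) (σ₀ b)))
          ((WeierstrassCurve.hasNonsingularReduction_some_algebraMap_iff hinj hns2).mp
            (hasNonsingularReduction_of_isUnit_Δ hv0 hΔ _)) := by
      rw [← WeierstrassCurve.reducePoint_some_algebraMap hinj hns2]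
      congr 1
      exact point_some_congr (by rw [keyX, hX2]) (by rw [keyY, hY2])
    have e₁ : WeierstrassCurve.reducePoint W₀ (.some x' y' hnsΦ) =
        WeierstrassCurve.reducePoint W₀ (.some x' y'
          (hW₀ ▸ (VariableChange.nonsingular_iff (X.baseChange L) C x y).mpr h)) := rfl
    have e₂ : WeierstrassCurve.reducePoint W₀ (.some (C.toX (σ x)) (C.toY (σ x) (σ y)) hnsΦσ) =
        WeierstrassCurve.reducePoint W₀ (.some (C.toX (σ x)) (C.toY (σ x) (σ y))
          (hW₀ ▸ (VariableChange.nonsingular_iff (X.baseChange L) C (σ x) (σ y)).mpr hσns)) := rfl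
    rw [← e₂, ← e₁, hred₂, hred₁, VariableChange.pointEquiv_some, Affine.Point.congrEquiv_some]
    refine point_some_congr ?_ ?_
    · rw [map_toX_ringHom, hres]
    · rw [map_toY_ringHom, hres, hres]
  · -- point of the kernel of reduction: both sides are `Õ`
    rw [not_le] at hxint
    have hx1 : x' ∉ Set.range (algebraMap O L) := (not_mem_range_iff hv0).mpr hxint
    have hx2 : C.toX (σ x) ∉ Set.range (algebraMap O L) := by
      rw [not_mem_range_iff hv0, keyX, VariableChange.toX_def, map_mul, map_pow,
        Units.val_inv_eq_inv_val, map_inv₀, hu, inv_one, one_pow, one_mul]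
      have hlt : w A.r < w (σ x') := by rw [hσ]; exact lt_of_le_of_lt hr hxint
      rw [Valuation.map_sub_eq_of_lt_left w hlt, hσ]
      exact hxint
    have e₁ : WeierstrassCurve.reducePoint W₀ (.some x' y'
        (hW₀ ▸ (VariableChange.nonsingular_iff (X.baseChange L) C x y).mpr h)) = 0 :=
      WeierstrassCurve.reducePoint_some_of_not_mem _ hx1
    have e₂ : WeierstrassCurve.reducePoint W₀ (.some (C.toX (σ x)) (C.toY (σ x) (σ y))
        (hW₀ ▸ (VariableChange.nonsingular_iff (X.baseChange L) C (σ x) (σ y)).mpr hσns)) = 0 :=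
      WeierstrassCurve.reducePoint_some_of_not_mem _ hx2
    rw [e₁, e₂, map_zero, map_zero]

end Core

/-! ## §2. The criterion: `σ` fixes `X[3]` iff `A_σ ≡ 1 (mod 𝔪_w)` -/

section Criterion

variable {L : Type u} [Field L] {w : Valuation L ℝ≥0}
  {F : Type*} [Field F] [Algebra F L]

set_option maxHeartbeats 1600000 in
/-- **Inertia fixes the `3`-torsion iff the reduced automorphism is trivial, i.e. iff
`A_σ = C(σC)⁻¹ ≡ 1 (mod 𝔪_w)`.**  Setting of `exists_integralLift_reducedAut_red_map_eq` with `L`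
algebraically closed of characteristic `0`, `X` elliptic and `w(3) = 1`.  Then `σ` fixes every
`3`-torsion point of `X(L)` iff `w(u_A - 1) < 1`, `w(r_A) < 1`, `w(s_A) < 1` and `w(t_A) < 1`.
`⇐`: then `Ã = 1`, `red(Φ(P^σ)) = red(Φ P)`, and `Φ(P^σ - P)` is a `3`-torsion point of the kernel
of reduction, i.e. `O` (*AEC* VII.3.1(b)).  `⇒`: the nine points of `X[3]` (`card_torsionBy_eq_sq`)
have pairwise distinct reductions (VII.3.1(b) again), all fixed by `Ã`; a non-zero one `R₁ = (x₁, y₁)`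
has `-R₁ = (x₁, y₁') ≠ R₁` (`2R₁ = 3R₁ = O` would force `R₁ = O`), and not all eight non-zero ones
lie over `x₁` (at most two points over an abscissa), so some `R₂ = (x₂, y₂)` has `x₂ ≠ x₁`, and
`Ã = 1` by `VariableChange.eq_one_of_three_fixedPoints`.  No torsion coordinates enter: this is the
coordinate-free form of the question "does `Γ^u` move `E[3]`?" used for the wild conductor above
`2` (Silverman *ATAEC* IV.10, p. 358: `δ` only sees which `G_i` act trivially).
[cite: SerreTate1968, §2 Thm. 2 and §3] [cite: SilvermanAEC2009, VII.3 Prop. 3.1(b), III.10]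
[cite: SilvermanATAEC1994, §IV.10 (PDF p. 358)] -/
theorem forall_map_three_torsion_eq_iff_val [IsAlgClosed L] [CharZero L]
    (X : WeierstrassCurve F) [(X.baseChange L).IsElliptic] (C : VariableChange L)
    {W₀ : WeierstrassCurve w.integer} (hW₀ : C • X.baseChange L = W₀.baseChange L)
    (hΔ : IsUnit W₀.Δ) (σ : L ≃ₐ[F] L) (hσ : ∀ z, w (σ z) = w z)
    (hσI : ∀ z, w z ≤ 1 → w (σ z - z) < 1) (h3 : w (3 : L) = 1) :
    (∀ P : (X.baseChange L).toAffine.Point, (3 : ℤ) • P = 0 →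
        Affine.Point.map (σ : L →ₐ[F] L) P = P) ↔
      (w (((C * (C.map (σ : L →+* L))⁻¹).u : L) - 1) < 1 ∧
        w (C * (C.map (σ : L →+* L))⁻¹).r < 1 ∧
        w (C * (C.map (σ : L →+* L))⁻¹).s < 1 ∧ w (C * (C.map (σ : L →+* L))⁻¹).t < 1) := by
  have hv0 : w.Integers w.integer := Valuation.integer.integers w
  haveI hell : (W₀.map (IsLocalRing.residue w.integer)).IsElliptic := isElliptic_map_residue hΔ
  obtain ⟨A₀, hÃ, hA₀A, hcore⟩ :=
    exists_integralLift_reducedAut_red_map_eq X C hW₀ hΔ σ hσ hσI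
  let O := w.integer
  let k := IsLocalRing.ResidueField w.integer
  set A : VariableChange L := C * (C.map (σ : L →+* L))⁻¹ with hA
  set Ã : VariableChange k := A₀.map (IsLocalRing.residue O) with hÃdef
  -- notation `Φ`, `red`, `𝔄`
  set Φ : (X.baseChange L).toAffine.Point ≃+ (W₀.baseChange L).toAffine.Point :=
    (VariableChange.pointEquiv (X.baseChange L) C).trans (Affine.Point.congrEquiv hW₀) with hΦ
  set red := goodReductionHom W₀ hv0 hΔ with hred
  set 𝔄 : (W₀.map (IsLocalRing.residue O)).toAffine.Point ≃+
      (W₀.map (IsLocalRing.residue O)).toAffine.Point :=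
    (VariableChange.pointEquiv _ Ã).trans (Affine.Point.congrEquiv hÃ) with h𝔄
  have hcore' : ∀ Q : (X.baseChange L).toAffine.Point,
      red (Φ (Affine.Point.map (σ : L →ₐ[F] L) Q)) = 𝔄 (red (Φ Q)) := fun Q ↦ hcore Q
  have h3ℤ : w ((3 : ℤ) : L) = 1 := by exact_mod_cast h3
  -- components of `A` through `A₀`
  have hAu : (A.u : L) = algebraMap O L (A₀.u : O) := by
    rw [← hA₀A]; simp only [VariableChange.map, Units.coe_map, MonoidHom.coe_coe]; rfl
  have hAr : A.r = algebraMap O L A₀.r := by rw [← hA₀A]; rfl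
  have hAs : A.s = algebraMap O L A₀.s := by rw [← hA₀A]; rfl
  have hAt : A.t = algebraMap O L A₀.t := by rw [← hA₀A]; rfl
  -- `Ã = 1` iff the congruences
  have hiff : Ã = 1 ↔ (w ((A.u : L) - 1) < 1 ∧ w A.r < 1 ∧ w A.s < 1 ∧ w A.t < 1) := by
    rw [hAu, hAr, hAs, hAt, ← map_one (algebraMap O L), ← map_sub,
      v_algebraMap_lt_one_iff hv0, v_algebraMap_lt_one_iff hv0, v_algebraMap_lt_one_iff hv0,
      v_algebraMap_lt_one_iff hv0, map_sub, map_one, sub_eq_zero]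
    constructor
    · intro h1
      have hu : Ã.u = 1 := by rw [h1]; rfl
      have hr : Ã.r = 0 := by rw [h1]; rfl
      have hs : Ã.s = 0 := by rw [h1]; rfl
      have ht : Ã.t = 0 := by rw [h1]; rfl
      refine ⟨?_, hr, hs, ht⟩
      have := congrArg (fun z : kˣ => (z : k)) hu
      simpa [hÃdef, VariableChange.map] using this
    · rintro ⟨hu, hr, hs, ht⟩
      have hu' : Ã.u = 1 := Units.ext (by simpa [hÃdef, VariableChange.map] using hu)
      rw [hÃdef] at hu' ⊢
      cases A₀
      simp only [VariableChange.map, VariableChange.one_def, VariableChange.mk.injEq] at hu' hr hs ht ⊢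
      exact ⟨hu', hr, hs, ht⟩
  rw [← hiff]
  -- `red ∘ Φ` is injective on the `3`-torsion
  have hinj3 : ∀ Q : (X.baseChange L).toAffine.Point, (3 : ℤ) • Q = 0 → red (Φ Q) = 0 → Q = 0 := by
    intro Q hQ h0
    have hΦ0 : Φ Q = 0 :=
      eq_zero_of_zsmul_eq_zero_of_goodReductionHom_eq_zero hv0 hΔ h3ℤ
        (by rw [← map_zsmul, hQ, map_zero]) h0
    exact Φ.injective (by rw [hΦ0, map_zero])
  constructor
  · -- `⇒`: three fixed reduced points
    intro hfix
    have hfixR : ∀ Q : (X.baseChange L).toAffine.Point, (3 : ℤ) • Q = 0 →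
        𝔄 (red (Φ Q)) = red (Φ Q) := by
      intro Q hQ
      rw [← hcore', hfix Q hQ]
    -- a non-zero `3`-torsion point `P₁` (nine of them)
    have h3L : ((3 : ℕ) : L) ≠ 0 := by exact_mod_cast (three_ne_zero : (3 : L) ≠ 0)
    have hcard := card_torsionBy_eq_sq (E := X.baseChange L) h3L
    set T3 := AddSubgroup.torsionBy (X.baseChange L).toAffine.Point ((3 : ℕ) : ℤ) with hT3
    haveI : Finite T3 := Nat.finite_of_card_ne_zero (by rw [hcard]; norm_num)
    have hmem3 : ∀ Q : T3, (3 : ℤ) • (Q : (X.baseChange L).toAffine.Point) = 0 := fun Q ↦ by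
      have := (Submodule.mem_torsionBy_iff _ _).mp Q.2
      exact_mod_cast this
    -- the map `Q ↦ red (Φ Q)` on `T3` is injective
    have hinjT : Function.Injective (fun Q : T3 ↦ red (Φ (Q : (X.baseChange L).toAffine.Point))) := by
      intro Q₁ Q₂ h
      apply Subtype.ext
      have h12 : (3 : ℤ) • ((Q₁ : (X.baseChange L).toAffine.Point) - Q₂) = 0 := by
        rw [smul_sub, hmem3, hmem3, sub_zero]
      have h0 : red (Φ ((Q₁ : (X.baseChange L).toAffine.Point) - Q₂)) = 0 := by
        rw [map_sub, map_sub]; exact sub_eq_zero.mpr h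
      exact sub_eq_zero.mp (hinj3 _ h12 h0)
    -- pick `P₁ ≠ 0` in `T3`
    obtain ⟨P₁, hP₁0⟩ : ∃ P₁ : T3, (P₁ : (X.baseChange L).toAffine.Point) ≠ 0 := by
      by_contra hall
      push Not at hall
      have hsub : ∀ Q : T3, Q = ⟨0, AddSubgroup.zero_mem _⟩ := fun Q ↦ Subtype.ext (hall Q)
      haveI : Subsingleton T3 := ⟨fun a b => by rw [hsub a, hsub b]⟩
      have := Nat.card_of_subsingleton (⟨0, AddSubgroup.zero_mem _⟩ : T3)
      rw [hcard] at this
      norm_num at this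
    set R₁ := red (Φ (P₁ : (X.baseChange L).toAffine.Point)) with hR₁
    have hR₁0 : R₁ ≠ 0 := fun h ↦ hP₁0 (hinj3 _ (hmem3 P₁) h)
    have h3R₁ : (3 : ℤ) • R₁ = 0 := by rw [hR₁, ← map_zsmul, ← map_zsmul, hmem3, map_zero, map_zero]
    have hR₁neg : R₁ ≠ -R₁ := by
      intro h
      have h2 : (2 : ℤ) • R₁ = 0 := by rw [two_zsmul]; nth_rewrite 2 [h]; exact add_neg_cancel R₁
      have e : ((3 : ℤ) - 2) • R₁ = (3 : ℤ) • R₁ - (2 : ℤ) • R₁ := sub_smul _ _ _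
      rw [h3R₁, h2, sub_zero, show ((3 : ℤ) - 2) = 1 by norm_num, one_smul] at e
      exact hR₁0 e
    -- coordinates of `R₁` and `-R₁`
    rcases hR₁c : R₁ with _ | ⟨x₁, y₁, h₁⟩
    · exact absurd hR₁c hR₁0
    have hneg : -R₁ = .some x₁ ((W₀.map (IsLocalRing.residue O)).toAffine.negY x₁ y₁)
        ((Affine.nonsingular_neg ..).mpr h₁) := by rw [hR₁c, Affine.Point.neg_some]
    have hy : y₁ ≠ (W₀.map (IsLocalRing.residue O)).toAffine.negY x₁ y₁ := by
      intro h
      apply hR₁neg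
      rw [hneg, hR₁c]
      exact point_some_congr rfl h
    -- some `3`-torsion point reduces outside the abscissa `x₁`
    obtain ⟨P₂, x₂, y₂, h₂, hP₂, hx⟩ : ∃ (P₂ : T3) (x₂ y₂ : k)
        (h₂ : (W₀.map (IsLocalRing.residue O)).toAffine.Nonsingular x₂ y₂),
        red (Φ (P₂ : (X.baseChange L).toAffine.Point)) = .some x₂ y₂ h₂ ∧ x₂ ≠ x₁ := by
      by_contra hnone
      push Not at hnone
      -- then every `red (Φ Q)`, `Q ∈ T3`, lies in `{0, R₁, -R₁}`
      have hin : ∀ Q : T3, red (Φ (Q : (X.baseChange L).toAffine.Point)) = 0 ∨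
          red (Φ (Q : (X.baseChange L).toAffine.Point)) = R₁ ∨
          red (Φ (Q : (X.baseChange L).toAffine.Point)) = -R₁ := by
        intro Q
        rcases hQc : red (Φ (Q : (X.baseChange L).toAffine.Point)) with _ | ⟨x, y, h⟩
        · exact Or.inl rfl
        · right
          have hxx : x = x₁ := hnone Q x y h hQc
          subst hxx
          rcases Affine.Y_eq_of_X_eq h.left h₁.left rfl with hyy | hyy
          · left; rw [hR₁c]; exact point_some_congr rfl hyy
          · right; rw [hneg]; exact point_some_congr rfl hyy
      -- so `T3` injects into the three-element finset `{0, R₁, -R₁}`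
      set S3 : Finset (W₀.map (IsLocalRing.residue O)).toAffine.Point := {0, R₁, -R₁} with hS3
      have hmemS : ∀ Q : T3, red (Φ (Q : (X.baseChange L).toAffine.Point)) ∈ S3 := by
        intro Q
        rw [hS3]
        simp only [Finset.mem_insert, Finset.mem_singleton]
        exact hin Q
      let f : T3 → S3 := fun Q => ⟨_, hmemS Q⟩
      have hf : Function.Injective f := by
        intro Q₁ Q₂ hQ
        apply hinjT
        exact congrArg (fun z : S3 => (z : (W₀.map (IsLocalRing.residue O)).toAffine.Point)) hQ
      have hle := Nat.card_le_card_of_injective f hf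
      rw [hcard, Nat.card_eq_fintype_card, Fintype.card_coe] at hle
      have h3 : S3.card ≤ 3 := Finset.card_le_three
      omega
    -- the three fixed points
    have hfix₁ : 𝔄 (.some x₁ y₁ h₁) = .some x₁ y₁ h₁ := by
      have := hfixR _ (hmem3 P₁); rwa [← hR₁, hR₁c] at this
    have hfix₁' : 𝔄 (-R₁) = -R₁ := by rw [map_neg, hR₁, hfixR _ (hmem3 P₁)]
    rw [hneg] at hfix₁'
    have hfix₂ : 𝔄 (.some x₂ y₂ h₂) = .some x₂ y₂ h₂ := by
      have := hfixR _ (hmem3 P₂); rwa [hP₂] at this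
    exact VariableChange.eq_one_of_three_fixedPoints hÃ h₁ _ h₂ hy hx hfix₁ hfix₁' hfix₂
  · -- `⇐`: `Ã = 1`, so `red ∘ Φ` is `σ`-invariant
    intro hÃ1 P hP
    have h𝔄 : ∀ R, 𝔄 R = R := fun R ↦
      VariableChange.congrEquiv_pointEquiv_eq_self_of_eq_one hÃ hÃ1 R
    have hinv : red (Φ (Affine.Point.map (σ : L →ₐ[F] L) P)) = red (Φ P) := by rw [hcore', h𝔄]
    have hmP : (3 : ℤ) • (Affine.Point.map (σ : L →ₐ[F] L) P - P) = 0 := by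
      rw [smul_sub, ← map_zsmul, hP, map_zero, zero_sub, neg_eq_zero]
    have h0 : red (Φ (Affine.Point.map (σ : L →ₐ[F] L) P - P)) = 0 := by
      rw [map_sub, map_sub, hinv, sub_self]
    exact sub_eq_zero.mp (hinj3 _ hmP h0)

end Criterion

end Literature.NumberTheory.EllipticCurves

/-! ## §3. Number-field form: `σ ∈ I_𝔓` fixes `E[3]` iff `A_σ ≡ 1 (mod 𝔓)` -/

namespace WeierstrassCurve

open Literature.NumberTheory.EllipticCurves Literature.NumberTheory.GaloisRepresentations Field
  IsDedekindDomain

variable {K : Type u} [Field K] [NumberField K] (W : WeierstrassCurve K)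

set_option maxHeartbeats 1600000 in
/-- **An inertia element fixes `E[3]` iff its automorphism of an explicit good model is trivial
modulo `𝔓`.**  Let `E/K` be an elliptic curve over a number field, `v ∤ 3` a finite place,
`𝔓 ∣ v` a prime of `\bar ℤ_K`, `F/K` a normal subextension of `K̄` and `C = (u, r, s, t)` a change of
variables over `F` such that `W' = C • E_F` is a **good model at `𝔓`**: its coefficients are
`𝔓`-integral and its discriminant is a `𝔓`-unit (given as fractions `n/d` of absolute integers with
`d ∉ 𝔓`, resp. `n, d ∉ 𝔓`).  For `σ ∈ I_𝔓` put `A_σ := C · (σC)⁻¹` (`σ` acting on `F` through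
`σ|_F`), and write its entries `u_A - 1, r_A, s_A, t_A` as fractions `n_•/d_•` with `d_• ∉ 𝔓`.
Then **`σ` fixes every point of `E[3]` iff `n_u, n_r, n_s, n_t ∈ 𝔓`**, i.e. iff
`A_σ ≡ (1; 0, 0, 0) (mod 𝔓)`.  Proof: cut `𝔓` out by an embedding `ι : K̄ → K̄_v`, lift `σ` to a
local inertial isometry of the spectral valuation (Neukirch II (9.6),
`exists_mem_inertia_apply_eq_holds`; `spectralValuation_smul`, `mem_inertia_iff_spectralValuation`),
transport the good model along `ι` (its coefficients have spectral valuation `≤ 1`, its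
discriminant `= 1`), identify the `3`-torsion of `E(K̄_v)` with that of `E(K̄)`
(`exists_pointsMapOfEmb_eq_of_nsmul_eq_zero`, `pointsMapOfEmb_smul`), and apply the valued-field
criterion `forall_map_three_torsion_eq_iff_val`, in which `A_{σ_v} = ι(A_σ)`.  The point of the
statement: no coordinates of torsion points are needed to decide whether `Γ_K^u(𝔓)` moves `E[3]`,
only an explicit good model over an explicit field — the input of the wild conductor above `2`
(Silverman *ATAEC* §IV.10, `δ`; Thm. IV.11.1, `p = 2`).
[cite: SerreTate1968, §2 Thm. 2 and Cor. 2, §3]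
[cite: SilvermanAEC2009, VII.1 Prop. 1.3(d), VII.3 Prop. 3.1(b), VII.5 Prop. 5.5]
[cite: SilvermanATAEC1994, §IV.10 (PDF p. 358), Thm. IV.11.1 (p. 366)] -/
theorem forall_smul_geomTorsion_three_eq_iff_of_goodModel [W.IsElliptic]
    {v : HeightOneSpectrum (𝓞 K)} (h3 : (3 : 𝓞 K) ∉ v.asIdeal)
    {𝔓 : Ideal (absIntegers (𝓞 K) K)} (h𝔓 : 𝔓 ∈ v.primesAbove)
    (F : IntermediateField K (AlgebraicClosure K)) [Normal K F] (C : VariableChange F)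
    (ha₁ : ∃ n d : absIntegers (𝓞 K) K, d ∉ 𝔓 ∧
      (((C • W.baseChange F).a₁ : F) : AlgebraicClosure K) * d = n)
    (ha₂ : ∃ n d : absIntegers (𝓞 K) K, d ∉ 𝔓 ∧
      (((C • W.baseChange F).a₂ : F) : AlgebraicClosure K) * d = n)
    (ha₃ : ∃ n d : absIntegers (𝓞 K) K, d ∉ 𝔓 ∧
      (((C • W.baseChange F).a₃ : F) : AlgebraicClosure K) * d = n)
    (ha₄ : ∃ n d : absIntegers (𝓞 K) K, d ∉ 𝔓 ∧
      (((C • W.baseChange F).a₄ : F) : AlgebraicClosure K) * d = n)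
    (ha₆ : ∃ n d : absIntegers (𝓞 K) K, d ∉ 𝔓 ∧
      (((C • W.baseChange F).a₆ : F) : AlgebraicClosure K) * d = n)
    (hΔ : ∃ n d : absIntegers (𝓞 K) K, n ∉ 𝔓 ∧ d ∉ 𝔓 ∧
      (((C • W.baseChange F).Δ : F) : AlgebraicClosure K) * d = n)
    {σ : absoluteGaloisGroup K} (hσ : σ ∈ 𝔓.inertia (absoluteGaloisGroup K))
    {nu du nr dr ns ds nt dt : absIntegers (𝓞 K) K}
    (hdu : du ∉ 𝔓) (hdr : dr ∉ 𝔓) (hds : ds ∉ 𝔓) (hdt : dt ∉ 𝔓)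
    (hAu : ((((C * (C.map (absRestrictNormalHom F σ : F →+* F))⁻¹).u : F) : AlgebraicClosure K) - 1) *
      du = nu)
    (hAr : (((C * (C.map (absRestrictNormalHom F σ : F →+* F))⁻¹).r : F) : AlgebraicClosure K) *
      dr = nr)
    (hAs : (((C * (C.map (absRestrictNormalHom F σ : F →+* F))⁻¹).s : F) : AlgebraicClosure K) *
      ds = ns)
    (hAt : (((C * (C.map (absRestrictNormalHom F σ : F →+* F))⁻¹).t : F) : AlgebraicClosure K) *
      dt = nt) :
    (∀ T : geomTorsion W (3 : ℕ), σ • T = T) ↔ (nu ∈ 𝔓 ∧ nr ∈ 𝔓 ∧ ns ∈ 𝔓 ∧ nt ∈ 𝔓) := by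
  let Kv := v.adicCompletion K
  let L := AlgebraicClosure (v.adicCompletion K)
  haveI : CharZero Kv := charZero_of_injective_algebraMap (algebraMap K Kv).injective
  haveI : CharZero L := charZero_of_injective_algebraMap (algebraMap Kv L).injective
  -- cut `𝔓` out by an embedding `ι : K̄ → K̄_v`
  obtain ⟨𝔐, h𝔐⟩ := v.localPrimesAbove_nonempty
  obtain ⟨g, hg⟩ := HeightOneSpectrum.exists_smul_eq_of_mem_primesAbove_holds
    (HeightOneSpectrum.primeBelow_mem_primesAbove (ι := closureEmb (K := K) Kv) h𝔐) h𝔓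
  set ι : AlgebraicClosure K →ₐ[K] L := (closureEmb (K := K) Kv).comp
    ((show AlgebraicClosure K ≃ₐ[K] AlgebraicClosure K from g⁻¹) :
      AlgebraicClosure K →ₐ[K] AlgebraicClosure K) with hι
  have h1 : 𝔓 = v.primeBelow ι 𝔐 := by
    rw [hι, HeightOneSpectrum.primeBelow_comp, ← hg]
    exact congrArg (· • _) (inv_inv g).symm
  -- a local inertia element `σv ∈ I_𝔐` above `σ`
  obtain ⟨σv, hσvI, hσv⟩ := v.exists_mem_inertia_apply_eq_holds ι h𝔐 (τ := σ)
    (by rw [← h1]; exact hσ)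
  have hres : resGalOfEmb ι σv = σ := resGalOfEmb_eq_of_apply_eq ι hσv
  -- the spectral valuation; `σv` is an inertial isometry
  obtain ⟨w, hw⟩ := v.exists_spectralValuation
  set σE : L ≃ₐ[Kv] L := absoluteGaloisGroup.toAlgEquiv _ σv with hσE
  have hσ₁ : ∀ z : L, w (σE z) = w z := fun z ↦ HeightOneSpectrum.spectralValuation_smul hw σv z
  have hσ₂ : ∀ z : L, w z ≤ 1 → w (σE z - z) < 1 :=
    (HeightOneSpectrum.mem_inertia_iff_spectralValuation hw h𝔐).mp hσvI
  have h3w : w (3 : L) = 1 := by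
    have := HeightOneSpectrum.spectralValuation_intCast_eq_one hw (n := 3) (by exact_mod_cast h3)
    exact_mod_cast this
  have hv0 : w.Integers w.integer := Valuation.integer.integers w
  -- valuations of absolute integers along `ι`
  have hwle : ∀ n : absIntegers (𝓞 K) K, w (ι n) ≤ 1 := fun n ↦ by
    have := (HeightOneSpectrum.mem_localAbsIntegers_iff_spectralValuation hw).mp
      (HeightOneSpectrum.absIntegersToLocal v ι n).2
    simpa only [HeightOneSpectrum.coe_absIntegersToLocal_apply] using this
  have hwlt : ∀ n : absIntegers (𝓞 K) K, w (ι n) < 1 ↔ n ∈ 𝔓 := fun n ↦ by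
    rw [h1, HeightOneSpectrum.mem_primeBelow_iff,
      HeightOneSpectrum.mem_iff_spectralValuation_lt_one hw h𝔐,
      HeightOneSpectrum.coe_absIntegersToLocal_apply]
  have hweq : ∀ d : absIntegers (𝓞 K) K, d ∉ 𝔓 → w (ι d) = 1 := fun d hd ↦
    le_antisymm (hwle d) (not_lt.mp fun h ↦ hd ((hwlt d).mp h))
  -- fractions `x d = n`
  have hfrac_le : ∀ {x : AlgebraicClosure K} {n d : absIntegers (𝓞 K) K}, d ∉ 𝔓 →
      x * d = n → w (ι x) ≤ 1 := by
    intro x n d hd hx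
    have e : w (ι x) * w (ι d) = w (ι n) := by rw [← map_mul, ← map_mul, hx]
    rw [hweq d hd, mul_one] at e
    rw [e]; exact hwle n
  have hfrac_lt : ∀ {x : AlgebraicClosure K} {n d : absIntegers (𝓞 K) K}, d ∉ 𝔓 →
      x * d = n → (w (ι x) < 1 ↔ n ∈ 𝔓) := by
    intro x n d hd hx
    have e : w (ι x) * w (ι d) = w (ι n) := by rw [← map_mul, ← map_mul, hx]
    rw [hweq d hd, mul_one] at e
    rw [e]; exact hwlt n
  have hfrac_one : ∀ {x : AlgebraicClosure K} {n d : absIntegers (𝓞 K) K}, n ∉ 𝔓 → d ∉ 𝔓 →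
      x * d = n → w (ι x) = 1 := by
    intro x n d hn hd hx
    have e : w (ι x) * w (ι d) = w (ι n) := by rw [← map_mul, ← map_mul, hx]
    rw [hweq d hd, mul_one, hweq n hn] at e
    exact e
  -- the embedding `F → L` and the transported good model
  set fF : F →+* L := (ι : AlgebraicClosure K →+* L).comp (algebraMap F (AlgebraicClosure K))
    with hfF
  have hfF_apply : ∀ z : F, fF z = ι (z : AlgebraicClosure K) := fun z ↦ rfl
  set X : WeierstrassCurve Kv := W.baseChange Kv with hX
  set CL : VariableChange L := C.map fF with hCL
  have hXL : X.baseChange L = (W.baseChange F).map fF := by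
    rw [hX, baseChange_baseChange_adicCompletion W v, WeierstrassCurve.baseChange,
      WeierstrassCurve.baseChange, WeierstrassCurve.map_map, hfF, RingHom.comp_assoc]
    congr 1
    ext z
    change algebraMap K L z = ι (algebraMap K (AlgebraicClosure K) z)
    rw [AlgHom.commutes]
  have hmodel : CL • X.baseChange L = (C • W.baseChange F).map fF := by
    rw [hXL, hCL, map_variableChange]
  obtain ⟨n₁, d₁, hd₁, e₁⟩ := ha₁
  obtain ⟨n₂, d₂, hd₂, e₂⟩ := ha₂
  obtain ⟨n₃, d₃, hd₃, e₃⟩ := ha₃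
  obtain ⟨n₄, d₄, hd₄, e₄⟩ := ha₄
  obtain ⟨n₆, d₆, hd₆, e₆⟩ := ha₆
  set W' := C • W.baseChange F with hW'
  set W₀ : WeierstrassCurve w.integer :=
    ⟨⟨fF W'.a₁, hfrac_le hd₁ e₁⟩, ⟨fF W'.a₂, hfrac_le hd₂ e₂⟩, ⟨fF W'.a₃, hfrac_le hd₃ e₃⟩,
      ⟨fF W'.a₄, hfrac_le hd₄ e₄⟩, ⟨fF W'.a₆, hfrac_le hd₆ e₆⟩⟩ with hW₀
  have hW₀L : W₀.baseChange L = W'.map fF := by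
    ext <;> rfl
  have hgood : CL • X.baseChange L = W₀.baseChange L := by rw [hmodel, hW₀L]
  have hΔ0 : IsUnit W₀.Δ := by
    apply (hv0.isUnit_iff_valuation_eq_one).mpr
    change w ((algebraMap w.integer L) W₀.Δ) = 1
    rw [← map_Δ]
    change w (W₀.baseChange L).Δ = 1
    rw [hW₀L, map_Δ]
    obtain ⟨n, d, hn, hd, e⟩ := hΔ
    exact hfrac_one hn hd e
  -- the valued-field criterion for `σE`
  have key := forall_map_three_torsion_eq_iff_val (w := w) X CL hgood hΔ0 σE hσ₁ hσ₂ h3w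
  -- (a) the left-hand sides agree: `E(K̄_v)[3]` comes from `E(K̄)[3]`
  let Φ₁ : localPoints W Kv ≃+ (X.baseChange L).toAffine.Point :=
    Affine.Point.congrEquiv (baseChange_baseChange_adicCompletion W v).symm
  have hΦ₁ : ∀ Q, Φ₁ (σv • Q) = Affine.Point.map (σE : L →ₐ[Kv] L) (Φ₁ Q) :=
    fun Q ↦ congrEquiv_smul W v σv Q
  have hleft : (∀ T : geomTorsion W (3 : ℕ), σ • T = T) ↔
      (∀ P : (X.baseChange L).toAffine.Point, (3 : ℤ) • P = 0 →
        Affine.Point.map (σE : L →ₐ[Kv] L) P = P) := by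
    constructor
    · intro hfix Q hQ
      have hQ' : (3 : ℕ) • Φ₁.symm Q = 0 := by
        apply Φ₁.injective
        rw [map_nsmul, AddEquiv.apply_symm_apply, map_zero, ← natCast_zsmul]
        exact_mod_cast hQ
      obtain ⟨P₀, hP₀, hP₀Q⟩ := exists_pointsMapOfEmb_eq_of_nsmul_eq_zero W ι three_ne_zero hQ'
      have hT : σ • P₀ = P₀ := by
        have := hfix ⟨P₀, (Submodule.mem_torsionBy_iff _ _).mpr (by exact_mod_cast hP₀)⟩
        exact congrArg Subtype.val this
      have hσQ : σv • Φ₁.symm Q = Φ₁.symm Q := by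
        rw [← hP₀Q, ← pointsMapOfEmb_smul, hres, hT]
      have := hΦ₁ (Φ₁.symm Q)
      rw [hσQ, AddEquiv.apply_symm_apply] at this
      exact this.symm
    · intro hloc T
      apply Subtype.ext
      set P : geomPoints W := (T : geomPoints W) with hP
      have h3P : (3 : ℕ) • P = 0 := by
        have := (Submodule.mem_torsionBy_iff _ _).mp T.2
        rw [hP]; exact_mod_cast this
      have hmP : (3 : ℤ) • Φ₁ (pointsMapOfEmb W ι P) = 0 := by
        rw [show (3 : ℤ) = ((3 : ℕ) : ℤ) by norm_num, natCast_zsmul, ← map_nsmul, ← map_nsmul, h3P,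
          map_zero, map_zero]
      have hloc' := hloc _ hmP
      apply pointsMapOfEmb_injective W ι
      change pointsMapOfEmb W ι (σ • P) = pointsMapOfEmb W ι P
      rw [← hres, pointsMapOfEmb_smul]
      apply Φ₁.injective
      rw [hΦ₁]
      exact hloc'
  -- (b) the right-hand sides agree: `A_{σ_v} = ι(A_σ)`
  set τ : F ≃ₐ[K] F := absRestrictNormalHom F σ with hτ
  set A : VariableChange F := C * (C.map (τ : F →+* F))⁻¹ with hA
  have hcomp : (σE : L →+* L).comp fF = fF.comp (τ : F →+* F) := by
    ext z
    change σE (ι (z : AlgebraicClosure K)) = ι ((τ z : F) : AlgebraicClosure K)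
    have e1 : σE (ι (z : AlgebraicClosure K)) = σv • ι (z : AlgebraicClosure K) := rfl
    rw [e1, ← hσv, hτ]
    congr 1
    exact (AlgEquiv.restrictNormal_commutes (absoluteGaloisGroup.toAlgEquiv K σ) F z).symm
  have hAL : CL * (CL.map (σE : L →+* L))⁻¹ = A.map fF := by
    rw [hCL, VariableChange.map_map, hcomp, ← VariableChange.map_map, hA]
    change _ = VariableChange.mapHom fF (C * (C.map (τ : F →+* F))⁻¹)
    rw [map_mul, map_inv]
    rfl
  have hright : (w ((((CL * (CL.map (σE : L →+* L))⁻¹).u : Lˣ) : L) - 1) < 1 ∧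
      w (CL * (CL.map (σE : L →+* L))⁻¹).r < 1 ∧ w (CL * (CL.map (σE : L →+* L))⁻¹).s < 1 ∧
      w (CL * (CL.map (σE : L →+* L))⁻¹).t < 1) ↔ (nu ∈ 𝔓 ∧ nr ∈ 𝔓 ∧ ns ∈ 𝔓 ∧ nt ∈ 𝔓) := by
    rw [hAL]
    have eu : (((A.map fF).u : Lˣ) : L) - 1 = ι (((A.u : F) : AlgebraicClosure K) - 1) := by
      rw [map_sub, map_one]
      simp only [VariableChange.map, Units.coe_map, MonoidHom.coe_coe]
      rfl
    have er : (A.map fF).r = ι ((A.r : F) : AlgebraicClosure K) := rfl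
    have es : (A.map fF).s = ι ((A.s : F) : AlgebraicClosure K) := rfl
    have et : (A.map fF).t = ι ((A.t : F) : AlgebraicClosure K) := rfl
    rw [eu, er, es, et, hfrac_lt hdu hAu, hfrac_lt hdr hAr, hfrac_lt hds hAs, hfrac_lt hdt hAt]
  rw [hleft, key, hright]

/-! ## §4. The wild conductor of `E[3]` through the upper filtration of an explicit field -/

attribute [local instance] AddSubgroup.torsionBy.zmodModule

/-- **`Sw_𝔓(E[3]) = 2 · vol {u > 0 : Gal(F/K)^u(𝔓 ∩ F) ⊄ N}`.**  Let `E/K` be an elliptic curve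
over a number field, `v ∤ 3`, `𝔓 ∣ v`, `F/K` a finite normal subextension of `K̄`, and
`N ⊆ Gal(F/K)` a set such that an inertia element `σ ∈ I_𝔓` fixes `E[3]` pointwise iff
`σ|_F ∈ N` — e.g. `N = {τ : A_τ ≡ 1 (mod 𝔓 ∩ F)}` for an explicit good model over `F`
(`forall_smul_geomTorsion_three_eq_iff_of_goodModel`).  Then the Swan conductor of `E[3]` at `𝔓`
is twice the measure of the set of `u > 0` at which the upper ramification group `Gal(F/K)^u` of
`𝔓 ∩ F` (item C9) leaves `N`:
`Sw_𝔓(E[3]) = Sw_𝔓(V₃ E) = 2 · vol {u > 0 : Γ_K^u moves E[3]}`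
(`swanConductorAt_rationalTate_eq_two_mul_volume`, Silverman *ATAEC* p. 370 in the upper
numbering) and `Γ_K^u ↠ Gal(F/K)^u` (`absUpperRamificationSubgroup_map_absRestrictNormalHom_holds`,
Herbrand), `Γ_K^u ≤ I_𝔓`.  So the wild conductor above `2` of any elliptic curve with an explicit
good model over an explicit field `F` is read off the upper filtration of `Gal(F/K)` alone.
[cite: SilvermanATAEC1994, §IV.10 Definition of δ (PDF p. 358); Thm. IV.11.1, p = 2 (p. 366)]
[cite: SerreLocalFields1979, Ch. IV §3 (Herbrand, Remark 1) and Ch. VI §2] -/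
theorem swanConductorAt_torsion_three_eq_two_mul_volume_of_forall_iff [W.IsElliptic]
    {v : HeightOneSpectrum (𝓞 K)} (h3 : (3 : 𝓞 K) ∉ v.asIdeal)
    {𝔓 : Ideal (absIntegers (𝓞 K) K)} (h𝔓 : 𝔓 ∈ v.primesAbove)
    (F : IntermediateField K (AlgebraicClosure K)) [FiniteDimensional K F] [Normal K F]
    (N : Set (F ≃ₐ[K] F))
    (hN : ∀ σ : absoluteGaloisGroup K, σ ∈ 𝔓.inertia (absoluteGaloisGroup K) →
      ((∀ T : geomTorsion W (3 : ℕ), σ • T = T) ↔ absRestrictNormalHom F σ ∈ N)) :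
    (W.torsionGaloisRep 3).swanConductorAt (𝓞 K) 𝔓 =
      2 * MeasureTheory.volume.real {u : ℝ | 0 < u ∧
        ∃ τ ∈ upperRamificationSubgroup (𝔓.comap (F.integralClosureToAbsIntegers (𝓞 K)))
          (F ≃ₐ[K] F) u, τ ∉ N} := by
  haveI : Fact (Nat.Prime 3) := ⟨Nat.prime_three⟩
  have h3' : ((3 : ℕ) : 𝓞 K) ∉ v.asIdeal := by exact_mod_cast h3
  have h := W.continuous_rationalGaloisRepTate_holds 3
  rw [← W.swanConductorAt_rationalTate_eq_swanConductorAt_torsion 3 h h3' h𝔓,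
    W.swanConductorAt_rationalTate_eq_two_mul_volume 3 h h3' h𝔓]
  congr 2
  ext u
  simp only [Set.mem_setOf_eq]
  refine and_congr_right fun hu ↦ ?_
  have hmap := absUpperRamificationSubgroup_map_absRestrictNormalHom_holds (K := K) h𝔓 F u
  have hle := absUpperRamificationSubgroup_le_inertia_holds (𝓞 K) (K := K) 𝔓 u
  constructor
  · rintro ⟨σ, hσ, T, hT⟩
    refine ⟨absRestrictNormalHom F σ, ?_, ?_⟩
    · rw [← hmap]; exact Subgroup.mem_map_of_mem _ hσ
    · intro hmem
      exact hT (((hN σ (hle hσ)).mpr hmem) T)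
  · rintro ⟨τ, hτ, hτN⟩
    rw [← hmap] at hτ
    obtain ⟨σ, hσ, rfl⟩ := Subgroup.mem_map.mp hτ
    refine ⟨σ, hσ, ?_⟩
    by_contra hall
    push Not at hall
    exact hτN ((hN σ (hle hσ)).mp fun T ↦ by simpa using hall T)

end WeierstrassCurve

end
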